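/-
Copyright (c) 2026 the pub-hodgecm-mathlib formalisation cell (harness21).  Prover seat hodgecm-mathlib-K2E5-p16 (g5): Track B «K2-LIT»,
hLiu418 = stmt-HodgeConjecture-24832, ROAD (R)+(C) of the rank-one archimedean Whittaker centre values (LEAD F0P6-plan (g13) deal
2026-09-04T09:45:33Z (1), for K2Liu-p11 (g1)'s FILE 2 `K2LiuRankOneArchWhittakerCentreKTypes`): the generic Paley–Wiener ∕ contour lemma (C).
-/
import Mathlib.Analysis.Complex.CauchyIntegral
import Mathlib.Analysis.SpecialFunctions.ImproperIntegrals
import Mathlib.MeasureTheory.Integral.IntegralEqImproper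
import HarnessLib

/-!
# Crux `HLiu418`, ROAD (R)+(C), lemma (C): a Fourier integral over `ℝ` of a function holomorphic and `O(1∕(1+|z|²))` on a closed half-plane
# vanishes for the wrong sign of the frequency

Cell `hodgecm-mathlib`, crux item hLiu418 = `stmt-HodgeConjecture-24832`, route of record `HCCMUnconditional`; squad K2, LEAD F0P6-plan (g13)
(deal (C) 09:45:33Z), prover K2E5-p16 (g5); consumer K2Liu-p11 (g1) ((R) + FILE 2).  THEOREMS ONLY; lane `--supports stmt-HodgeConjecture-24832
--as helper`.  Pure complex analysis, reusable capital (no Bessel values, no representation theory).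

WHAT.
* `integral_mul_phase_eq_zero_of_upperHalfPlane` — (C): if `F : ℂ → ℂ` is complex-differentiable on the CLOSED upper half-plane `{0 ≤ im z}`
  (as `DifferentiableOn`) and `‖F z‖ ≤ C ∕ (1 + ‖z‖²)` there, then for every `h < 0`,  `∫_ℝ F(b) e^{−2πihb} db = 0`.
  PROOF: Cauchy on the square `[−R, R] × [0, R]` (★ Mathlib `Complex.integral_boundary_rect_eq_zero_of_differentiableOn`); on `{im z ≥ 0}` the
  phase has modulus `e^{2πh·im z} ≤ 1`, so the top and the two sides are each `≤ 2RC∕(1+R²)` resp. `RC∕(1+R²)`; hence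
  `∫_{−R}^{R} → 0`, while `∫_{−R}^{R} → ∫_ℝ` (★ `intervalIntegral_tendsto_integral`, the integrand being `O((1+b²)⁻¹)`).
* `integral_mul_phase_eq_zero_of_lowerHalfPlane` — the mirror: `F` holomorphic and `O(1∕(1+|z|²))` on `{im z ≤ 0}`, `0 < h` ⇒ the same
  integral vanishes (`b ↦ −b`).
HONEST LABEL.  Count-neutral helper of the K2_Liu road; it pays no socket by itself: `HC_CM` is proved only modulo the 7 printed citations
(2 remaining named inputs: hLiu418 = `stmt-HodgeConjecture-24832`, h413 = `stmt-HodgeConjecture-24833`) until rung 0 closes.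
-/

set_option autoImplicit false
-- the mandated namespace repeats the single-problem summit's segment (`HodgeConjecture.HodgeConjecture`)
set_option linter.dupNamespace false

noncomputable section

open Complex MeasureTheory Set Filter Topology
open scoped Interval

namespace Summit.HodgeConjecture.HodgeConjecture.Cruxes.HLiu418.K2LiuPaleyWienerUpperHalfPlane

/-- The phase `e^{−2πihz}` has modulus `e^{2πh·im z}`. [folklore] -/
theorem norm_phase (h : ℝ) (z : ℂ) : ‖Complex.exp (-(2 * Real.pi * Complex.I * h * z))‖ = Real.exp (2 * Real.pi * h * z.im) := by
  rw [Complex.norm_exp]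
  congr 1
  simp only [neg_re, mul_re, re_ofNat, im_ofNat, ofReal_re, ofReal_im, I_re, I_im, mul_im, mul_zero, zero_mul, sub_zero, add_zero,
    mul_one, zero_sub, zero_add, neg_neg]

/-- On the closed upper half-plane and for `h ≤ 0` the phase has modulus `≤ 1`. [folklore] -/
theorem norm_phase_le_one {h : ℝ} (hh : h ≤ 0) {z : ℂ} (hz : 0 ≤ z.im) : ‖Complex.exp (-(2 * Real.pi * Complex.I * h * z))‖ ≤ 1 := by
  rw [norm_phase, Real.exp_le_one_iff]
  have : 2 * Real.pi * h ≤ 0 := mul_nonpos_of_nonneg_of_nonpos (by positivity) hh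
  exact mul_nonpos_of_nonpos_of_nonneg this hz

/-- The decay bound transported to the integrand: `‖F z · e^{−2πihz}‖ ≤ C ∕ (1 + ‖z‖²)` on `{im z ≥ 0}`, `h ≤ 0`. [folklore] -/
theorem norm_integrand_le {F : ℂ → ℂ} {C : ℝ} (hB : ∀ z : ℂ, 0 ≤ z.im → ‖F z‖ ≤ C / (1 + ‖z‖ ^ 2)) {h : ℝ} (hh : h ≤ 0) {z : ℂ}
    (hz : 0 ≤ z.im) : ‖F z * Complex.exp (-(2 * Real.pi * Complex.I * h * z))‖ ≤ C / (1 + ‖z‖ ^ 2) := by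
  have hC : 0 ≤ C := by
    have h0 := hB 0 (by simp)
    rw [norm_zero, zero_pow two_ne_zero, add_zero, div_one] at h0
    exact (norm_nonneg _).trans h0
  rw [norm_mul]
  exact (mul_le_mul (hB z hz) (norm_phase_le_one hh hz) (norm_nonneg _) (div_nonneg hC (by positivity))).trans_eq (mul_one _)

/-- On a vertical or horizontal edge at distance `≥ R` from the origin: `C ∕ (1 + ‖z‖²) ≤ C ∕ (1 + R²)` when `R² ≤ ‖z‖²`, `0 ≤ C`. [folklore] -/
theorem div_le_div_of_sq_le {C R : ℝ} (hC : 0 ≤ C) {z : ℂ} (hz : R ^ 2 ≤ ‖z‖ ^ 2) : C / (1 + ‖z‖ ^ 2) ≤ C / (1 + R ^ 2) :=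
  div_le_div_of_nonneg_left hC (by positivity) (by linarith)

/-- **(C) PALEY–WIENER ∕ CONTOUR LEMMA, upper half-plane.**  If `F` is complex-differentiable on the closed upper half-plane `{0 ≤ im z}` with
`‖F z‖ ≤ C ∕ (1 + ‖z‖²)` there, then `∫_ℝ F(b) e^{−2πihb} db = 0` for every `h < 0`. [folklore] (Paley–Wiener; Cauchy on squares) -/
theorem integral_mul_phase_eq_zero_of_upperHalfPlane {F : ℂ → ℂ} {C : ℝ} (hF : DifferentiableOn ℂ F {z : ℂ | 0 ≤ z.im})
    (hB : ∀ z : ℂ, 0 ≤ z.im → ‖F z‖ ≤ C / (1 + ‖z‖ ^ 2)) {h : ℝ} (hh : h < 0) :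
    ∫ b : ℝ, F b * Complex.exp (-(2 * Real.pi * Complex.I * h * b)) = 0 := by
  have hC : 0 ≤ C := by
    have h0 := hB 0 (by simp)
    rw [norm_zero, zero_pow two_ne_zero, add_zero, div_one] at h0
    exact (norm_nonneg _).trans h0
  set G : ℂ → ℂ := fun z => F z * Complex.exp (-(2 * Real.pi * Complex.I * h * z)) with hG
  -- `G` is holomorphic on the closed upper half-plane and `O(1∕(1+|z|²))` there
  have hGd : DifferentiableOn ℂ G {z : ℂ | 0 ≤ z.im} :=
    hF.mul (((differentiable_const _).mul differentiable_id).neg.cexp.differentiableOn)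
  have hGb : ∀ z : ℂ, 0 ≤ z.im → ‖G z‖ ≤ C / (1 + ‖z‖ ^ 2) := fun z hz => norm_integrand_le hB hh.le hz
  -- the restriction to `ℝ` is integrable
  have hGc : Continuous fun b : ℝ => G b :=
    (hGd.continuousOn.comp_continuous continuous_ofReal fun b => by simp).congr fun _ => rfl
  have hGi : Integrable fun b : ℝ => G b := by
    refine Integrable.mono' (integrable_inv_one_add_sq.const_mul C) hGc.aestronglyMeasurable (Eventually.of_forall fun b => ?_)
    have hb := hGb b (by simp)
    rw [Complex.norm_real, Real.norm_eq_abs, sq_abs] at hb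
    rwa [div_eq_mul_inv] at hb
  -- Cauchy on the square `[−R, R] × [0, R]`
  have hrect : ∀ R : ℝ, 0 < R →
      ‖∫ x : ℝ in -R..R, G x‖ ≤ 4 * R * (C / (1 + R ^ 2)) := by
    intro R hR
    have hsq : [[((-R : ℝ) : ℂ).re, ((R : ℂ) + R * I).re]] ×ℂ [[((-R : ℝ) : ℂ).im, ((R : ℂ) + R * I).im]] ⊆ {z : ℂ | 0 ≤ z.im} := by
      intro z hz
      rw [mem_reProdIm] at hz
      have him : z.im ∈ [[(0 : ℝ), R]] := by simpa using hz.2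
      rw [uIcc_of_le hR.le] at him
      exact him.1
    have hcau := Complex.integral_boundary_rect_eq_zero_of_differentiableOn G ((-R : ℝ) : ℂ) ((R : ℂ) + R * I) (hGd.mono hsq)
    have hre1 : ((-R : ℝ) : ℂ).re = -R := by simp
    have hre2 : ((R : ℂ) + R * I).re = R := by simp
    have him1 : ((-R : ℝ) : ℂ).im = 0 := by simp
    have him2 : ((R : ℂ) + R * I).im = R := by simp
    rw [hre1, hre2, him1, him2] at hcau
    simp only [ofReal_zero, zero_mul, add_zero] at hcau
    -- bottom = top − I • right + I • left
    have hbot : ∫ x : ℝ in -R..R, G x = (∫ x : ℝ in -R..R, G (x + R * I)) - I • (∫ y : ℝ in (0 : ℝ)..R, G (R + y * I)) +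
        I • (∫ y : ℝ in (0 : ℝ)..R, G (-R + y * I)) := by
      have e : ∫ y : ℝ in (0 : ℝ)..R, G (((-R : ℝ) : ℂ) + y * I) = ∫ y : ℝ in (0 : ℝ)..R, G (-R + y * I) := by simp
      rw [e] at hcau
      linear_combination hcau
    -- the three edges
    have htop : ‖∫ x : ℝ in -R..R, G (x + R * I)‖ ≤ C / (1 + R ^ 2) * |R - -R| := by
      refine intervalIntegral.norm_integral_le_of_norm_le_const fun x _ => ?_
      have hz : 0 ≤ ((x : ℂ) + R * I).im := by simp [hR.le]
      refine (hGb _ hz).trans (div_le_div_of_sq_le hC ?_)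
      rw [Complex.sq_norm, Complex.normSq_apply]
      simp only [add_re, ofReal_re, mul_re, I_re, mul_zero, ofReal_im, I_im, mul_one, sub_self, add_zero, add_im, mul_im, zero_add]
      nlinarith [sq_nonneg x]
    have hside : ∀ a : ℝ, a ^ 2 = R ^ 2 → ‖∫ y : ℝ in (0 : ℝ)..R, G (a + y * I)‖ ≤ C / (1 + R ^ 2) * |R - 0| := by
      intro a ha
      refine intervalIntegral.norm_integral_le_of_norm_le_const fun y hy => ?_
      rw [uIoc_of_le hR.le] at hy
      have hz : 0 ≤ ((a : ℂ) + y * I).im := by simp [hy.1.le]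
      refine (hGb _ hz).trans (div_le_div_of_sq_le hC ?_)
      rw [Complex.sq_norm, Complex.normSq_apply]
      simp only [add_re, ofReal_re, mul_re, I_re, mul_zero, ofReal_im, I_im, mul_one, sub_self, add_zero, add_im, mul_im, zero_add]
      nlinarith [sq_nonneg y]
    have hR1 := hside R rfl
    have hR2 := hside (-R) (by ring)
    have e2 : (((-R : ℝ) : ℂ)) = -(R : ℂ) := by push_cast; ring
    rw [e2] at hR2
    rw [show |R - -R| = 2 * R by rw [sub_neg_eq_add, abs_of_pos (by linarith)]; ring] at htop
    rw [show |R - 0| = R by rw [sub_zero, abs_of_pos hR] ] at hR1 hR2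
    rw [hbot]
    have hI : ∀ w : ℂ, ‖I • w‖ = ‖w‖ := fun w => by rw [norm_smul, Complex.norm_I, one_mul]
    calc ‖(∫ x : ℝ in -R..R, G (x + R * I)) - I • (∫ y : ℝ in (0 : ℝ)..R, G (R + y * I)) + I • (∫ y : ℝ in (0 : ℝ)..R, G (-R + y * I))‖
        ≤ ‖∫ x : ℝ in -R..R, G (x + R * I)‖ + ‖I • ∫ y : ℝ in (0 : ℝ)..R, G (R + y * I)‖ + ‖I • ∫ y : ℝ in (0 : ℝ)..R, G (-R + y * I)‖ :=
          (norm_add_le _ _).trans (add_le_add_left (norm_sub_le _ _) _)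
      _ ≤ C / (1 + R ^ 2) * (2 * R) + C / (1 + R ^ 2) * R + C / (1 + R ^ 2) * R := by
          rw [hI, hI]; exact add_le_add (add_le_add htop hR1) hR2
      _ = 4 * R * (C / (1 + R ^ 2)) := by ring
  -- `∫_{−R}^{R} G → 0` and `→ ∫_ℝ G`
  have hlim0 : Tendsto (fun R : ℝ => ∫ x : ℝ in -R..R, G x) atTop (𝓝 0) := by
    refine squeeze_zero_norm' (eventually_gt_atTop (0 : ℝ) |>.mono fun R hR => hrect R hR) ?_
    have h1 : Tendsto (fun R : ℝ => 4 * C * (R / (1 + R ^ 2))) atTop (𝓝 (4 * C * 0)) := by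
      refine (tendsto_const_nhds.mul ?_)
      have h2 : Tendsto (fun R : ℝ => R⁻¹) atTop (𝓝 0) := tendsto_inv_atTop_zero
      have h3 : ∀ᶠ R : ℝ in atTop, R / (1 + R ^ 2) ≤ R⁻¹ := (eventually_gt_atTop (0 : ℝ)).mono fun R hR => by
        rw [div_le_iff₀ (by positivity), inv_mul_eq_div, le_div_iff₀ hR]
        nlinarith
      have h4 : ∀ᶠ R : ℝ in atTop, 0 ≤ R / (1 + R ^ 2) := (eventually_ge_atTop (0 : ℝ)).mono fun R hR => by positivity
      exact squeeze_zero' h4 h3 h2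
    rw [mul_zero] at h1
    refine h1.congr' (Eventually.of_forall fun R => ?_)
    simp only; ring
  have hlim : Tendsto (fun R : ℝ => ∫ x : ℝ in -R..R, G x) atTop (𝓝 (∫ b : ℝ, G b)) :=
    intervalIntegral_tendsto_integral hGi tendsto_neg_atTop_atBot tendsto_id
  exact tendsto_nhds_unique hlim hlim0

/-- **(C), lower half-plane (the mirror).**  If `F` is complex-differentiable on `{im z ≤ 0}` with `‖F z‖ ≤ C ∕ (1 + ‖z‖²)` there, then
`∫_ℝ F(b) e^{−2πihb} db = 0` for every `0 < h`. [folklore] -/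
theorem integral_mul_phase_eq_zero_of_lowerHalfPlane {F : ℂ → ℂ} {C : ℝ} (hF : DifferentiableOn ℂ F {z : ℂ | z.im ≤ 0})
    (hB : ∀ z : ℂ, z.im ≤ 0 → ‖F z‖ ≤ C / (1 + ‖z‖ ^ 2)) {h : ℝ} (hh : 0 < h) :
    ∫ b : ℝ, F b * Complex.exp (-(2 * Real.pi * Complex.I * h * b)) = 0 := by
  -- apply the upper half-plane lemma to `z ↦ F (−z)` at the frequency `−h`, then substitute `b ↦ −b`
  have hF' : DifferentiableOn ℂ (fun z : ℂ => F (-z)) {z : ℂ | 0 ≤ z.im} :=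
    hF.comp differentiable_neg.differentiableOn fun z hz => by simpa using hz
  have hB' : ∀ z : ℂ, 0 ≤ z.im → ‖F (-z)‖ ≤ C / (1 + ‖z‖ ^ 2) := fun z hz => by
    have := hB (-z) (by simpa using hz)
    rwa [norm_neg] at this
  have h1 := integral_mul_phase_eq_zero_of_upperHalfPlane hF' hB' (neg_lt_zero.2 hh)
  rw [← h1, ← integral_neg_eq_self]
  refine integral_congr_ae (Eventually.of_forall fun b => ?_)
  simp only [ofReal_neg]
  ring_nf

end Summit.HodgeConjecture.HodgeConjecture.Cruxes.HLiu418.K2LiuPaleyWienerUpperHalfPlane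

end
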